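import Mathlib
import HarnessLib
import Summits.HubbardSuperconductivity.HubbardSuperconductivity.Theorems.KLProgrammeC4aPPKernelModelWindowJets

/-!
# Route `KLProgramme` — crux C4a, S3 brick (B4) «(B4)-UMK1», «(U1)-K-JETS-ALL-ORDERS» part 1: the CORE and the WEIGHT of the product-form pp kernel at every
# order — `∂ᵤᵏ Re[(−iω+e)⁻¹(iω+u)⁻¹]` with the Re/Im split, the weight's jets at every level, the support trades, the frequency sums

Cell `gate-hubbard-kl`, seat hubbard-kl-k3c3-p1 (g20; row «δμ-flow with klAngularMean constant piece»).  Kernel side of the ORDERS `2…4` of the (C)-closer's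
co-moving jets (stub (C) `stub_twoLeg_curvature` of `KLRegimeEngineV17F2`, stmt-HubbardSuperconductivity-20437; k3c3-p3 g38 memo `SWAP-BY-SYMMETRY.md` §6(b):
«`M₂…M₄` need no new caustic ladder — envelope rows `K″…K⁗` + Faà di Bruno + the window cover»).  Part 2 (`…C4aPPKernelTrueJetsAllOrders`) proves ONE envelope for
every order `k`: `|∂ᵤᵏ P(e,u)| ≤ (k+1)!·2^{2k+2}·(1+X)·max(Λ,|u|)^{−(k+1)}` for all `e, u`, uniformly in `β`; this part supplies the per-frequency ingredients.
MODEL (`…ModelWindow`, `…ModelWindowJets`): `P(e,u) = (2/β)Σₙ sₙ(e,u)`, `sₙ = W(ωₙ,e)·W(ωₙ,u)·c_ωₙ(e,u)`, `c_ω(e,u) = (eu+ω²)/((ω²+e²)(ω²+u²)) = Re[(−iω+e)⁻¹(iω+u)⁻¹]`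
(`re_inv_mul_inv_eq`), `W(ω,x) = χ₂((x²+ω²)/Λ²)`, `χ₂ = salmhoferCutoff` (`0` below `1/4`, `1` above `1`), `ωₙ = (2n+1)π/β`.
* §1 complex bookkeeping: `abs_im_pow_succ_le` (`|Im z^{k+1}| ≤ (k+1)|Im z|‖z‖ᵏ`), `abs_im_inv_pow_I_le` (`|Im (iω+u)^{−(k+1)}| ≤ (k+1)|ω|·‖iω+u‖^{−(k+2)}`),
  `abs_re_mul_le_abs` (`|Re(ab)| ≤ |Re a|·‖b‖ + |Im a|·|Im b|`), `inv_neg_I_mul_add_re_im` (the parts `e/(ω²+e²)`, `ω/(ω²+e²)` of `(−iω+e)⁻¹`),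
  `prod_neg_succ_eq` (`∏_{i<k}(−(1+i)) = (−1)ᵏk!` is REAL);
* §2 the core: `iteratedDeriv_pairCore_eq` (`∂ᵤᵏc = Re[(−iω+e)⁻¹·∏·(iω+u)^{−(k+1)}]`, via the Möbius jets of `…ModelWindowJets`), the FINE bound
  **`abs_iteratedDeriv_pairCore_le`** — `|∂ᵤᵏc| ≤ k!·|e|/(ω²+e²)·‖iω+u‖^{−(k+1)} + (k+1)!·‖iω+u‖^{−(k+2)}`: the Re/Im split; the first piece sums over the frequencies to
  `tanh(β|e|/2)/2`, the second carries the `|u|^{−(k+1)}` decay, and NEITHER produces the `log(|u|/Λ)` that per-frequency absolute values `‖(−iω+e)⁻¹‖ ≤ 1/ω` cost —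
  and the CRUDE one `abs_iteratedDeriv_pairCore_le_crude` (`≤ k!·‖(−iω+e)⁻¹‖·‖iω+u‖^{−(k+1)}`, for the shell terms);
* §3 the weight at every level: `iteratedDeriv_uvWeightFn_eq_zero_of_lt/_of_gt` (local constancy off the closed shell `Λ²/4 ≤ u²+ω² ≤ Λ²`),
  **`abs_iteratedDeriv_uvWeightFn_le`** (`|∂ᵤʲW(ω,·)(u)| ≤ j!·X·(4/Λ)ʲ` for ALL `u` — the Literature band-jet bound `HubbardUVWeightJets` on `|u| ≤ Λ`, vanishing above),
  and the support trades **`abs_uvWeightFn_mul_norm_inv_le`** (`|W(ω,e)|·‖(−iω+e)⁻¹‖ ≤ 2/Λ`), **`abs_uvWeightFn_mul_inv_norm_pow_le`** (`|W(ω,u)|·‖iω+u‖^{−p} ≤ m₀^{−p}`,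
  `m₀ = max(Λ/2,|u|)`), `abs_uvWeightFn_mul_inv_norm_pow_add_two_le` (`≤ m₀^{−p}·2/(ω²+m₀²)`, one Lorentzian kept for the `tanh` sum);
* §4 the frequency sums and the constant: `two_div_mul_tsum_abs_div_le` (`(2/β)Σₙ|e|/(ωₙ²+e²) ≤ 1/2`), `two_div_mul_tsum_one_div_le` (`(2/β)Σₙ1/(ωₙ²+m²) ≤ 1/(2m)`),
  `headline_const_le` (`k!2ᵏ + (k+1)!2^{k+1} + k·k!·X·2^{2k+2} ≤ (k+1)!·2^{2k+2}·(1+X)`).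
Pure real/complex analysis on landed objects; nothing asserts (C), any engine row, K3, the window or superconductivity.
References: BGM 2006 §2.1 (2.2)–(2.5), §2.2 (2.36aa), §2.4 (2.36) [cite: BenfattoGiulianiMastropietro2006]; Salmhofer 1999 §4.2.4 (4.63), §4.2.5 (4.70)–(4.71) [cite: Salmhofer1999].
-/

noncomputable section

namespace Summit.HubbardSuperconductivity.HubbardSuperconductivity.Theorems.C4a

set_option linter.dupNamespace false -- summit = problem name (single-conjunct summit), D-0017

open Real Filter Set Finset Complex
open scoped Topology Nat
open Literature.MathematicalPhysics.QuantumLattice Literature.Analysis.SpecialFunctions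

/-! ## §1 Complex bookkeeping: imaginary parts of powers and inverse powers, the Re/Im split -/

/-- `|Im z^{k+1}| ≤ (k+1)·|Im z|·‖z‖ᵏ`. [folklore] -/
theorem abs_im_pow_succ_le (z : ℂ) (k : ℕ) : |(z ^ (k + 1)).im| ≤ (k + 1) * |z.im| * ‖z‖ ^ k := by
  induction k with
  | zero => simp
  | succ k ih =>
    rw [pow_succ, Complex.mul_im]
    have h1 : |(z ^ (k + 1)).re| ≤ ‖z‖ ^ (k + 1) := (Complex.abs_re_le_norm _).trans (by rw [norm_pow])
    have h2 : |z.re| ≤ ‖z‖ := Complex.abs_re_le_norm z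
    have h3 : |(z ^ (k + 1)).re * z.im| ≤ ‖z‖ ^ (k + 1) * |z.im| := by
      rw [abs_mul]; exact mul_le_mul_of_nonneg_right h1 (abs_nonneg _)
    have h4 : |(z ^ (k + 1)).im * z.re| ≤ (k + 1) * |z.im| * ‖z‖ ^ k * ‖z‖ := by
      rw [abs_mul]; exact mul_le_mul ih h2 (abs_nonneg _) (by positivity)
    calc |(z ^ (k + 1)).re * z.im + (z ^ (k + 1)).im * z.re|
        ≤ |(z ^ (k + 1)).re * z.im| + |(z ^ (k + 1)).im * z.re| := abs_add_le _ _
      _ ≤ ‖z‖ ^ (k + 1) * |z.im| + (k + 1) * |z.im| * ‖z‖ ^ k * ‖z‖ := add_le_add h3 h4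
      _ = (↑(k + 1) + 1) * |z.im| * ‖z‖ ^ (k + 1) := by push_cast; ring

/-- `|Im (z⁻¹)^{k+1}| ≤ (k+1)·|Im z|·‖z‖^{−(k+2)}` (`z ≠ 0`). [folklore] -/
theorem abs_im_inv_pow_succ_le {z : ℂ} (hz : z ≠ 0) (k : ℕ) :
    |((z⁻¹) ^ (k + 1)).im| ≤ (k + 1) * |z.im| * (1 / ‖z‖) ^ (k + 2) := by
  have hz0 : 0 < ‖z‖ := norm_pos_iff.2 hz
  have hpos : (0 : ℝ) < (‖z‖ ^ (k + 1)) ^ 2 := by positivity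
  rw [inv_pow, Complex.inv_im, abs_div, abs_neg, Complex.normSq_eq_norm_sq, norm_pow, abs_of_pos hpos, div_le_iff₀ hpos]
  have hpow : (1 / ‖z‖) ^ (k + 2) * (‖z‖ ^ (k + 1)) ^ 2 = ‖z‖ ^ k := by
    rw [one_div_pow, ← pow_mul, div_mul_eq_mul_div, one_mul, div_eq_iff (by positivity), ← pow_add]
    ring_nf
  calc |(z ^ (k + 1)).im| ≤ (k + 1) * |z.im| * ‖z‖ ^ k := abs_im_pow_succ_le z k
    _ = (k + 1) * |z.im| * ((1 / ‖z‖) ^ (k + 2) * (‖z‖ ^ (k + 1)) ^ 2) := by rw [hpow]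
    _ = (k + 1) * |z.im| * (1 / ‖z‖) ^ (k + 2) * (‖z‖ ^ (k + 1)) ^ 2 := by ring

/-- For `ω ≠ 0`: `|Im (iω+u)^{−(k+1)}| ≤ (k+1)·|ω|·‖iω+u‖^{−(k+2)}`. [folklore] -/
theorem abs_im_inv_pow_I_le {ω : ℝ} (hω : ω ≠ 0) (k : ℕ) (u : ℝ) :
    |(((I * ω + (u : ℂ))⁻¹) ^ (k + 1)).im| ≤ (k + 1) * |ω| * (1 / ‖I * ω + (u : ℂ)‖) ^ (k + 2) := by
  have h := abs_im_inv_pow_succ_le (I_mul_add_ofReal_ne_zero hω u) k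
  have him : (I * ω + (u : ℂ)).im = ω := by simp
  rwa [him] at h

/-- The Re/Im split: `|Re(ab)| ≤ |Re a|·‖b‖ + |Im a|·|Im b|`. [folklore] -/
theorem abs_re_mul_le_abs (a b : ℂ) : |(a * b).re| ≤ |a.re| * ‖b‖ + |a.im| * |b.im| := by
  rw [Complex.mul_re]
  calc |a.re * b.re - a.im * b.im| ≤ |a.re * b.re| + |a.im * b.im| := abs_sub _ _
    _ = |a.re| * |b.re| + |a.im| * |b.im| := by rw [abs_mul, abs_mul]
    _ ≤ |a.re| * ‖b‖ + |a.im| * |b.im| := by gcongr; exact Complex.abs_re_le_norm b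

/-- The parts of the loop factor: `Re (−iω+e)⁻¹ = e/(ω²+e²)`, `Im (−iω+e)⁻¹ = ω/(ω²+e²)`. [folklore] -/
theorem inv_neg_I_mul_add_re_im (ω e : ℝ) :
    ((-I * ω + (e : ℂ))⁻¹).re = e / (ω ^ 2 + e ^ 2) ∧ ((-I * ω + (e : ℂ))⁻¹).im = ω / (ω ^ 2 + e ^ 2) := by
  have h1 : Complex.normSq (-I * ω + (e : ℂ)) = ω ^ 2 + e ^ 2 := by rw [Complex.normSq_apply]; simp; ring
  refine ⟨?_, ?_⟩
  · rw [Complex.inv_re, h1]; simp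
  · rw [Complex.inv_im, h1]; simp

/-- `∏_{i<k}(−(1+i)) = (−1)ᵏ·k!` — in particular a REAL number. [folklore] -/
theorem prod_neg_succ_eq (k : ℕ) : ∏ i ∈ Finset.range k, (-((0 + 1 + i : ℕ) : ℂ)) = (((-1 : ℝ) ^ k * k ! : ℝ) : ℂ) := by
  induction k with
  | zero => simp
  | succ k ih =>
    rw [Finset.prod_range_succ, ih, Nat.factorial_succ]
    push_cast
    ring

/-- `Im(r·z) = r·Im z` for the real constant `∏_{i<k}(−(1+i))`. [folklore] -/
theorem im_prod_neg_succ_mul (k : ℕ) (z : ℂ) :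
    ((∏ i ∈ Finset.range k, (-((0 + 1 + i : ℕ) : ℂ))) * z).im = ((-1 : ℝ) ^ k * k !) * z.im := by
  rw [prod_neg_succ_eq, Complex.im_ofReal_mul]

/-! ## §2 The core `c_ω(e,u) = (eu+ω²)/((ω²+e²)(ω²+u²)) = Re[(−iω+e)⁻¹(iω+u)⁻¹]`: all jets, fine and crude bounds -/

/-- **`∂ᵤᵏ c = Re[(−iω+e)⁻¹·∏_{i<k}(−(1+i))·(iω+u)^{−(k+1)}]`**. [folklore] -/
theorem iteratedDeriv_pairCore_eq {ω : ℝ} (hω : ω ≠ 0) (e : ℝ) (k : ℕ) (u : ℝ) :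
    iteratedDeriv k (fun v : ℝ => (e * v + ω ^ 2) / ((ω ^ 2 + e ^ 2) * (ω ^ 2 + v ^ 2))) u =
      ((-I * ω + (e : ℂ))⁻¹ * ((∏ i ∈ Finset.range k, (-((0 + 1 + i : ℕ) : ℂ))) * ((I * ω + (u : ℂ))⁻¹) ^ (0 + 1 + k))).re := by
  have hfun : (fun v : ℝ => (e * v + ω ^ 2) / ((ω ^ 2 + e ^ 2) * (ω ^ 2 + v ^ 2))) =
      fun v : ℝ => ((-I * ω + (e : ℂ))⁻¹ * (I * ω + (v : ℂ))⁻¹).re := funext fun v => (re_inv_mul_inv_eq ω e v).symm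
  have hG : ContDiff ℝ (k : ℕ∞) (fun v : ℝ => (-I * ω + (e : ℂ))⁻¹ * (I * ω + (v : ℂ))⁻¹) := contDiff_const.mul (contDiff_inv_I hω)
  rw [hfun, iteratedDeriv_re_eq hG le_rfl, iteratedDeriv_const_mul_field, iteratedDeriv_inv_I hω]

/-- The core is `C^∞` in the partner level. [folklore] -/
theorem contDiff_pairCore {ω : ℝ} (hω : ω ≠ 0) (e : ℝ) {N : ℕ∞} :
    ContDiff ℝ N (fun v : ℝ => (e * v + ω ^ 2) / ((ω ^ 2 + e ^ 2) * (ω ^ 2 + v ^ 2))) := by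
  have hne : ∀ v : ℝ, (ω ^ 2 + e ^ 2) * (ω ^ 2 + v ^ 2) ≠ 0 := fun v => by positivity
  exact ContDiff.div (by fun_prop) (by fun_prop) hne

/-- **The FINE core jet bound** (Re/Im split): `|∂ᵤᵏ c| ≤ k!·(|e|/(ω²+e²))·‖iω+u‖^{−(k+1)} + (k+1)!·‖iω+u‖^{−(k+2)}` (`0 < ω`).
The first piece sums over the frequencies to `tanh(β|e|/2)/2`, the second carries the `|u|^{−(k+1)}` decay; neither produces `log(|u|/Λ)`. [folklore] -/
theorem abs_iteratedDeriv_pairCore_le {ω : ℝ} (hω : 0 < ω) (e : ℝ) (k : ℕ) (u : ℝ) :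
    |iteratedDeriv k (fun v : ℝ => (e * v + ω ^ 2) / ((ω ^ 2 + e ^ 2) * (ω ^ 2 + v ^ 2))) u| ≤
      k ! * (|e| / (ω ^ 2 + e ^ 2)) * (1 / ‖I * ω + (u : ℂ)‖) ^ (k + 1) + (k + 1)! * (1 / ‖I * ω + (u : ℂ)‖) ^ (k + 2) := by
  rw [iteratedDeriv_pairCore_eq hω.ne' e k u]
  set a : ℂ := (-I * ω + (e : ℂ))⁻¹ with ha
  set w : ℂ := I * ω + (u : ℂ) with hw
  have hwne : w ≠ 0 := I_mul_add_ofReal_ne_zero hω.ne' u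
  have hw0 : 0 < ‖w‖ := norm_pos_iff.2 hwne
  obtain ⟨hare, haim⟩ := inv_neg_I_mul_add_re_im ω e
  refine (abs_re_mul_le_abs a _).trans ?_
  -- sizes of the pieces
  have hb_norm : ‖(∏ i ∈ Finset.range k, (-((0 + 1 + i : ℕ) : ℂ))) * (w⁻¹) ^ (0 + 1 + k)‖ ≤ k ! * (1 / ‖w‖) ^ (k + 1) := by
    rw [norm_mul, norm_prod_neg_succ, norm_pow, norm_inv, zero_add, add_comm 1 k, one_div]
  have hb_im : |((∏ i ∈ Finset.range k, (-((0 + 1 + i : ℕ) : ℂ))) * (w⁻¹) ^ (0 + 1 + k)).im| ≤ k ! * ((k + 1) * |ω| * (1 / ‖w‖) ^ (k + 2)) := by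
    rw [im_prod_neg_succ_mul, abs_mul, zero_add, add_comm 1 k]
    have h1 : |(-1 : ℝ) ^ k * (k ! : ℝ)| = k ! := by rw [abs_mul, abs_pow, abs_neg, abs_one, one_pow, one_mul, Nat.abs_cast]
    rw [h1]
    exact mul_le_mul_of_nonneg_left (abs_im_inv_pow_I_le hω.ne' k u) (Nat.cast_nonneg _)
  have hden : (0 : ℝ) < ω ^ 2 + e ^ 2 := by positivity
  have hare' : |a.re| = |e| / (ω ^ 2 + e ^ 2) := by rw [ha, hare, abs_div, abs_of_pos hden]
  have haim' : |a.im| = ω / (ω ^ 2 + e ^ 2) := by rw [ha, haim, abs_div, abs_of_pos hω, abs_of_pos hden]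
  rw [hare', haim']
  have hω1 : ω / (ω ^ 2 + e ^ 2) * (k ! * ((k + 1) * |ω| * (1 / ‖w‖) ^ (k + 2))) ≤ (k + 1)! * (1 / ‖w‖) ^ (k + 2) := by
    rw [abs_of_pos hω, Nat.factorial_succ]
    push_cast
    have h2 : ω / (ω ^ 2 + e ^ 2) * ω ≤ 1 := by
      rw [div_mul_eq_mul_div, div_le_one (by positivity)]; nlinarith [sq_nonneg e]
    have h3 : 0 ≤ (k ! : ℝ) * (k + 1) * (1 / ‖w‖) ^ (k + 2) := by positivity
    calc ω / (ω ^ 2 + e ^ 2) * (k ! * ((k + 1) * ω * (1 / ‖w‖) ^ (k + 2)))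
        = (ω / (ω ^ 2 + e ^ 2) * ω) * ((k ! : ℝ) * (k + 1) * (1 / ‖w‖) ^ (k + 2)) := by ring
      _ ≤ 1 * ((k ! : ℝ) * (k + 1) * (1 / ‖w‖) ^ (k + 2)) := mul_le_mul_of_nonneg_right h2 h3
      _ = (k + 1) * k ! * (1 / ‖w‖) ^ (k + 2) := by ring
  calc |e| / (ω ^ 2 + e ^ 2) * ‖(∏ i ∈ Finset.range k, (-((0 + 1 + i : ℕ) : ℂ))) * (w⁻¹) ^ (0 + 1 + k)‖ +
        ω / (ω ^ 2 + e ^ 2) * |((∏ i ∈ Finset.range k, (-((0 + 1 + i : ℕ) : ℂ))) * (w⁻¹) ^ (0 + 1 + k)).im|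
      ≤ |e| / (ω ^ 2 + e ^ 2) * (k ! * (1 / ‖w‖) ^ (k + 1)) + ω / (ω ^ 2 + e ^ 2) * (k ! * ((k + 1) * |ω| * (1 / ‖w‖) ^ (k + 2))) := by
        gcongr
    _ ≤ k ! * (|e| / (ω ^ 2 + e ^ 2)) * (1 / ‖w‖) ^ (k + 1) + (k + 1)! * (1 / ‖w‖) ^ (k + 2) := by rw [mul_left_comm]; linarith

/-- **The CRUDE core jet bound**: `|∂ᵤᵏ c| ≤ k!·‖(−iω+e)⁻¹‖·‖iω+u‖^{−(k+1)}`. [folklore] -/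
theorem abs_iteratedDeriv_pairCore_le_crude {ω : ℝ} (hω : 0 < ω) (e : ℝ) (k : ℕ) (u : ℝ) :
    |iteratedDeriv k (fun v : ℝ => (e * v + ω ^ 2) / ((ω ^ 2 + e ^ 2) * (ω ^ 2 + v ^ 2))) u| ≤
      k ! * ‖(-I * ω + (e : ℂ))⁻¹‖ * (1 / ‖I * ω + (u : ℂ)‖) ^ (k + 1) := by
  rw [iteratedDeriv_pairCore_eq hω.ne' e k u]
  refine (Complex.abs_re_le_norm _).trans ?_
  rw [norm_mul, norm_mul, norm_prod_neg_succ, norm_pow, norm_inv (I * ω + (u : ℂ)), zero_add, add_comm 1 k, one_div]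
  exact le_of_eq (by ring)

/-! ## §3 The weight `u ↦ W(ω,u) = χ₂((u²+ω²)/Λ²)` at every level -/

/-- Below the shell the weight vanishes identically near `u`, hence so do all its jets: `u²+ω² < Λ²/4 ⟹ ∂ᵤʲW(ω,·)(u) = 0`. [cite: Salmhofer1999, §4.2.5 (4.71)] -/
theorem iteratedDeriv_uvWeightFn_eq_zero_of_lt {Λ : ℝ} (hΛ : 0 < Λ) {ω u : ℝ} (h : u ^ 2 + ω ^ 2 < Λ ^ 2 / 4) (j : ℕ) :
    iteratedDeriv j (fun v : ℝ => uvWeightFn Λ ω v) u = 0 := by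
  have hev : (fun v : ℝ => uvWeightFn Λ ω v) =ᶠ[𝓝 u] fun _ => (0 : ℝ) := by
    have hopen : IsOpen {v : ℝ | v ^ 2 + ω ^ 2 < Λ ^ 2 / 4} := isOpen_lt (by fun_prop) continuous_const
    filter_upwards [hopen.mem_nhds h] with v hv
    exact (uvWeightFn_eq_zero_of_lt hΛ hv).1
  rw [hev.iteratedDeriv_eq, iteratedDeriv_const]
  simp

/-- Above the shell the weight is identically `1` near `u`, hence its jets of order `≥ 1` vanish: `Λ² < u²+ω² ⟹ ∂ᵤʲW(ω,·)(u) = 0` (`1 ≤ j`).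
[cite: Salmhofer1999, §4.2.5 (4.71)] -/
theorem iteratedDeriv_uvWeightFn_eq_zero_of_gt {Λ : ℝ} (hΛ : 0 < Λ) {ω u : ℝ} (h : Λ ^ 2 < u ^ 2 + ω ^ 2) {j : ℕ} (hj : 1 ≤ j) :
    iteratedDeriv j (fun v : ℝ => uvWeightFn Λ ω v) u = 0 := by
  have hev : (fun v : ℝ => uvWeightFn Λ ω v) =ᶠ[𝓝 u] fun _ => (1 : ℝ) := by
    have hopen : IsOpen {v : ℝ | Λ ^ 2 < v ^ 2 + ω ^ 2} := isOpen_lt continuous_const (by fun_prop)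
    filter_upwards [hopen.mem_nhds h] with v hv
    exact (uvWeightFn_eq_one_of_gt hΛ hv).1
  rw [hev.iteratedDeriv_eq, iteratedDeriv_const]
  have : j ≠ 0 := Nat.one_le_iff_ne_zero.1 hj
  simp [this]

/-- The cutoff-jet constant dominates `1` (the cutoff takes the value `1`). [folklore] -/
theorem one_le_of_cutoff_jets {j : ℕ} {X : ℝ} (hX : ∀ l ≤ j, ∀ x : ℝ, ‖iteratedFDeriv ℝ l salmhoferCutoff x‖ ≤ X) : 1 ≤ X := by
  have h1 := hX 0 (Nat.zero_le _) 1
  rw [norm_iteratedFDeriv_zero, salmhoferCutoff_of_ge le_rfl] at h1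
  simpa using h1

/-- **The weight's jets at EVERY level**: `|∂ᵤʲ W(ω,·)(u)| ≤ j!·X·(4/Λ)ʲ` for all `u` (on the shell `|u| ≤ Λ` this is the Literature band-jet bound; above it the
jets of order `≥ 1` vanish and `|W| ≤ 1 ≤ X`). [cite: BenfattoGiulianiMastropietro2006, §2.2 (2.36aa)] -/
theorem abs_iteratedDeriv_uvWeightFn_le {Λ : ℝ} (hΛ : 0 < Λ) (ω : ℝ) {j : ℕ} {X : ℝ}
    (hX : ∀ l ≤ j, ∀ x : ℝ, ‖iteratedFDeriv ℝ l salmhoferCutoff x‖ ≤ X) (u : ℝ) :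
    |iteratedDeriv j (fun v : ℝ => uvWeightFn Λ ω v) u| ≤ j ! * X * (4 / Λ) ^ j := by
  have hX1 : 1 ≤ X := one_le_of_cutoff_jets hX
  by_cases hu : |u| ≤ Λ
  · have h := norm_iteratedFDeriv_uvWeightFn_band_le_of_abs_le hΛ ω hX hu
    rwa [norm_iteratedFDeriv_eq_norm_iteratedDeriv, Real.norm_eq_abs] at h
  · have hΛu : Λ < |u| := lt_of_not_ge hu
    have hgt : Λ ^ 2 < u ^ 2 + ω ^ 2 := by
      have h1 : Λ ^ 2 < |u| ^ 2 := by gcongr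
      rw [sq_abs] at h1
      nlinarith [sq_nonneg ω]
    rcases Nat.eq_zero_or_pos j with rfl | hj
    · simp only [iteratedDeriv_zero, Nat.factorial_zero, Nat.cast_one, pow_zero, one_mul, mul_one]
      exact (abs_uvWeightFn_le_one _ _ _).trans hX1
    · rw [iteratedDeriv_uvWeightFn_eq_zero_of_gt hΛ hgt hj, abs_zero]; positivity

/-- `‖iω+u‖² = ω²+u²`. [folklore] -/
theorem norm_I_mul_add_sq (ω u : ℝ) : ‖I * ω + (u : ℂ)‖ ^ 2 = ω ^ 2 + u ^ 2 := by
  rw [Complex.sq_norm, Complex.normSq_apply]; simp; ring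

/-- `‖−iω+e‖² = ω²+e²`. [folklore] -/
theorem norm_neg_I_mul_add_sq (ω e : ℝ) : ‖-I * ω + (e : ℂ)‖ ^ 2 = ω ^ 2 + e ^ 2 := by
  rw [Complex.sq_norm, Complex.normSq_apply]; simp; ring

/-- **Support trade on the loop leg**: `|W(ω,e)|·‖(−iω+e)⁻¹‖ ≤ 2/Λ` — where the weight is alive, `ω²+e² > Λ²/4`. [cite: Salmhofer1999, §4.2.5 (4.71)] -/
theorem abs_uvWeightFn_mul_norm_inv_le {Λ : ℝ} (hΛ : 0 < Λ) (ω e : ℝ) :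
    |uvWeightFn Λ ω e| * ‖(-I * ω + (e : ℂ))⁻¹‖ ≤ 2 / Λ := by
  by_cases h : e ^ 2 + ω ^ 2 < Λ ^ 2 / 4
  · rw [(uvWeightFn_eq_zero_of_lt hΛ h).1, abs_zero, zero_mul]; positivity
  · push Not at h
    have hge : Λ / 2 ≤ ‖-I * ω + (e : ℂ)‖ := by
      by_contra hlt
      push Not at hlt
      have h0 : 0 ≤ ‖-I * ω + (e : ℂ)‖ := norm_nonneg _
      have h2 : ‖-I * ω + (e : ℂ)‖ ^ 2 < (Λ / 2) ^ 2 := by gcongr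
      rw [norm_neg_I_mul_add_sq] at h2
      linarith
    rw [norm_inv]
    calc |uvWeightFn Λ ω e| * ‖-I * ω + (e : ℂ)‖⁻¹ ≤ 1 * (Λ / 2)⁻¹ :=
          mul_le_mul (abs_uvWeightFn_le_one _ _ _) (inv_anti₀ (by positivity) hge) (inv_nonneg.2 (norm_nonneg _)) zero_le_one
      _ = 2 / Λ := by field_simp

/-- Where the partner-leg weight is alive, `‖iω+u‖ ≥ max(Λ/2, |u|)`. [cite: Salmhofer1999, §4.2.5 (4.71)] -/
theorem max_le_norm_I_mul_add_of_alive (Λ : ℝ) {ω u : ℝ} (h : Λ ^ 2 / 4 ≤ u ^ 2 + ω ^ 2) :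
    max (Λ / 2) |u| ≤ ‖I * ω + (u : ℂ)‖ := by
  refine max_le ?_ ?_
  · by_contra hlt
    push Not at hlt
    have h0 : 0 ≤ ‖I * ω + (u : ℂ)‖ := norm_nonneg _
    have h2 : ‖I * ω + (u : ℂ)‖ ^ 2 < (Λ / 2) ^ 2 := by gcongr
    rw [norm_I_mul_add_sq] at h2
    linarith
  · have := Complex.abs_re_le_norm (I * ω + (u : ℂ))
    simpa using this

/-- **Support trade on the partner leg**: `|W(ω,u)|·‖iω+u‖^{−p} ≤ max(Λ/2,|u|)^{−p}`. [cite: Salmhofer1999, §4.2.5 (4.71)] -/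
theorem abs_uvWeightFn_mul_inv_norm_pow_le {Λ : ℝ} (hΛ : 0 < Λ) (ω u : ℝ) (p : ℕ) :
    |uvWeightFn Λ ω u| * (1 / ‖I * ω + (u : ℂ)‖) ^ p ≤ (1 / max (Λ / 2) |u|) ^ p := by
  by_cases h : u ^ 2 + ω ^ 2 < Λ ^ 2 / 4
  · rw [(uvWeightFn_eq_zero_of_lt hΛ h).1, abs_zero, zero_mul]; positivity
  · push Not at h
    have hm : 0 < max (Λ / 2) |u| := lt_max_of_lt_left (by positivity)
    have hge := max_le_norm_I_mul_add_of_alive Λ h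
    calc |uvWeightFn Λ ω u| * (1 / ‖I * ω + (u : ℂ)‖) ^ p ≤ 1 * (1 / max (Λ / 2) |u|) ^ p :=
          mul_le_mul (abs_uvWeightFn_le_one _ _ _) (pow_le_pow_left₀ (by positivity) (one_div_le_one_div_of_le hm hge) p)
            (by positivity) zero_le_one
      _ = (1 / max (Λ / 2) |u|) ^ p := one_mul _

/-- **Support trade keeping one Lorentzian**: `|W(ω,u)|·‖iω+u‖^{−(p+2)} ≤ max(Λ/2,|u|)^{−p}·2/(ω² + max(Λ/2,|u|)²)` (on the support
`2‖iω+u‖² ≥ ω² + max(Λ/2,|u|)²`). [cite: Salmhofer1999, §4.2.5 (4.71)] -/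
theorem abs_uvWeightFn_mul_inv_norm_pow_add_two_le {Λ : ℝ} (hΛ : 0 < Λ) (ω u : ℝ) (p : ℕ) :
    |uvWeightFn Λ ω u| * (1 / ‖I * ω + (u : ℂ)‖) ^ (p + 2) ≤ (1 / max (Λ / 2) |u|) ^ p * (2 / (ω ^ 2 + max (Λ / 2) |u| ^ 2)) := by
  by_cases h : u ^ 2 + ω ^ 2 < Λ ^ 2 / 4
  · rw [(uvWeightFn_eq_zero_of_lt hΛ h).1, abs_zero, zero_mul]; positivity
  · push Not at h
    set m := max (Λ / 2) |u| with hm_def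
    have hm : 0 < m := lt_max_of_lt_left (by positivity)
    have hge : m ≤ ‖I * ω + (u : ℂ)‖ := max_le_norm_I_mul_add_of_alive Λ h
    have hw0 : 0 < ‖I * ω + (u : ℂ)‖ := hm.trans_le hge
    have hsq := norm_I_mul_add_sq ω u
    -- `2‖w‖² ≥ ω² + m²`
    have h2 : ω ^ 2 + m ^ 2 ≤ 2 * ‖I * ω + (u : ℂ)‖ ^ 2 := by
      have hm2 : m ^ 2 ≤ ‖I * ω + (u : ℂ)‖ ^ 2 := by gcongr
      nlinarith [sq_nonneg u]
    have hinv2 : (1 / ‖I * ω + (u : ℂ)‖) ^ 2 ≤ 2 / (ω ^ 2 + m ^ 2) := by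
      rw [one_div_pow, div_le_div_iff₀ (by positivity) (by positivity)]
      linarith
    have hinvp : (1 / ‖I * ω + (u : ℂ)‖) ^ p ≤ (1 / m) ^ p := pow_le_pow_left₀ (by positivity) (one_div_le_one_div_of_le hm hge) p
    calc |uvWeightFn Λ ω u| * (1 / ‖I * ω + (u : ℂ)‖) ^ (p + 2)
        = |uvWeightFn Λ ω u| * ((1 / ‖I * ω + (u : ℂ)‖) ^ p * (1 / ‖I * ω + (u : ℂ)‖) ^ 2) := by rw [pow_add]
      _ ≤ 1 * ((1 / m) ^ p * (2 / (ω ^ 2 + m ^ 2))) :=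
          mul_le_mul (abs_uvWeightFn_le_one _ _ _) (mul_le_mul hinvp hinv2 (by positivity) (by positivity)) (by positivity) zero_le_one
      _ = (1 / m) ^ p * (2 / (ω ^ 2 + m ^ 2)) := one_mul _

/-! ## §4 The frequency sums and the headline constant -/

/-- The loop-leg sum is `tanh(β|e|/2)/2 ≤ 1/2`: `(2/β)Σₙ |e|/(ωₙ²+e²) ≤ 1/2` (no `log`, no `β`). [cite: BenfattoGiulianiMastropietro2006, §2.1 (2.2)-(2.5)] -/
theorem two_div_mul_tsum_abs_div_le {β : ℝ} (hβ : 0 < β) (e : ℝ) : 2 / β * ∑' n : ℕ, |e| / (ppFreq β n ^ 2 + e ^ 2) ≤ 1 / 2 := by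
  by_cases he : e = 0
  · simp [he]
  · have hae : 0 < |e| := abs_pos.2 he
    have h1 : ∑' n : ℕ, |e| / (ppFreq β n ^ 2 + e ^ 2) = |e| * ∑' n : ℕ, 1 / (ppFreq β n ^ 2 + |e| ^ 2) := by
      rw [← tsum_mul_left]; exact tsum_congr fun n => by rw [sq_abs]; ring
    rw [h1, tsum_one_div_ppFreq_sq_add_sq hβ hae.ne']
    have ht : Real.tanh (β * |e| / 2) ≤ 1 := (Real.tanh_lt_one _).le
    calc 2 / β * (|e| * (β * Real.tanh (β * |e| / 2) / (4 * |e|))) = Real.tanh (β * |e| / 2) / 2 := by field_simp; ring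
      _ ≤ 1 / 2 := by linarith

/-- `(2/β)Σₙ 1/(ωₙ²+m²) = tanh(βm/2)/(2m) ≤ 1/(2m)` (`0 < m`). [cite: BenfattoGiulianiMastropietro2006, §2.1 (2.2)-(2.5)] -/
theorem two_div_mul_tsum_one_div_le {β : ℝ} (hβ : 0 < β) {m : ℝ} (hm : 0 < m) : 2 / β * ∑' n : ℕ, 1 / (ppFreq β n ^ 2 + m ^ 2) ≤ 1 / (2 * m) := by
  rw [tsum_one_div_ppFreq_sq_add_sq hβ hm.ne']
  have ht : Real.tanh (β * m / 2) ≤ 1 := (Real.tanh_lt_one _).le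
  calc 2 / β * (β * Real.tanh (β * m / 2) / (4 * m)) = Real.tanh (β * m / 2) / (2 * m) := by field_simp; ring
    _ ≤ 1 / (2 * m) := by gcongr

/-- Factorial/power bookkeeping for the headline constant: `k!·2ᵏ + (k+1)!·2^{k+1} + k·k!·X·2^{2k+2} ≤ (k+1)!·2^{2k+2}·(1+X)` (`0 ≤ X`). [folklore] -/
theorem headline_const_le (k : ℕ) {X : ℝ} (hX : 0 ≤ X) :
    (k ! : ℝ) * 2 ^ k + (k + 1)! * 2 ^ (k + 1) + k * k ! * X * 2 ^ (2 * k + 2) ≤ (k + 1)! * 2 ^ (2 * k + 2) * (1 + X) := by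
  have hf : (k ! : ℝ) ≤ (k + 1)! := by exact_mod_cast Nat.factorial_le (Nat.le_succ k)
  have hkf : (k : ℝ) * k ! ≤ (k + 1)! := by
    rw [Nat.factorial_succ]; push_cast; nlinarith [(Nat.cast_nonneg k : (0 : ℝ) ≤ k), (Nat.cast_nonneg (k !) : (0 : ℝ) ≤ k !)]
  have h2k : (2 : ℝ) ^ k ≤ 2 ^ (2 * k) := pow_le_pow_right₀ (by norm_num) (by omega)
  have h22 : (2 : ℝ) ^ (2 * k + 2) = 4 * 2 ^ (2 * k) := by rw [pow_add]; ring
  have h21 : (2 : ℝ) ^ (k + 1) = 2 * 2 ^ k := by rw [pow_succ]; ring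
  rw [h22, h21]
  have hk0 : (0 : ℝ) ≤ k ! := Nat.cast_nonneg _
  have hp0 : (0 : ℝ) ≤ 2 ^ k := by positivity
  have hq0 : (0 : ℝ) ≤ 2 ^ (2 * k) := by positivity
  nlinarith [mul_nonneg hk0 hp0, mul_nonneg (sub_nonneg.2 hf) hq0, mul_nonneg (sub_nonneg.2 hkf) (mul_nonneg hX hq0),
    mul_nonneg hk0 (sub_nonneg.2 h2k), mul_nonneg (sub_nonneg.2 hf) hp0]

end Summit.HubbardSuperconductivity.HubbardSuperconductivity.Theorems.C4a

end
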